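import Summits.KontsevichZagierPeriods.Zeta5Search.Barrier.ConeGammaCuspPeriodLovasz

/-!
# ζ(5) search — BARRIER: THE TYPE OF THE PERIOD — convexity of the cusp slope from ONE modularity hypothesis

HONEST FRAMING (cell `pub-zeta5`): systematic search; no irrationality claim unless kernel-certified. MODEL objects
under Brown–Zudilin's (28)+(30) accounting ([BZ22] = arXiv:2210.03391; (28) observed, not proved); nothing here is a
statement about `ζ(5)`, any `γ` of record, the cone's supremum (C2 OPEN) or the value / sign of the cusp slope or the
modularity type of the period pattern function at a named direction (DATA of the cell: at record/41, flag/60, argmax-120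
and t*/480 the desk finds walls of both kink signs, so NONE of the three pure types holds there); S-E stays CONJECTURED;
records in print UNMOVED. Prover P2 g31, item «ONE SET FUNCTION» (INBOX 2026-08-27), file (2).

With the data of `ConeGammaCuspPeriodLovasz` (junction finsets `M m`, pattern functions `f m` with the agreement
hypotheses `hf`, and the period pattern function `F(A) = Σ_m f m (A ∩ M m)` on all subsets of the 28 forms), the type
of the period is a hypothesis on `F` ALONE — strictly weaker than P2 g30's junction-by-junction hypotheses (every `f m`
submodular makes `F` submodular, not conversely: the local defect of `F` behind a prefix at a wall `r_k = r_l` is the SUM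
of the junction defects on that wall, so kinks of different junctions across one wall may cancel):
* SUBMODULAR `F` (`F(A ∪ B) + F(A ∩ B) ≤ F(A) + F(B)`): **`greedy_period_le_cuspSlope_of_submodular`** (every chamber
  functional under-estimates `σ` everywhere — `σ` is their MAXIMUM), **`cuspSlope_subadditive_of_submodular_period`**,
  `convexOn_cuspSlope_of_submodular_period`, `cuspSlope_symm_nonneg_of_submodular_period`, and
  **`cuspSlope_eq_zero_of_submodular_period_of_nonpos`**: `σ ≤ 0` in every direction forces `σ ≡ 0` — whence
  **`cuspSlope_eq_zero_of_submodular_period_of_isLocalMax`** (P2 g23's hypotheses verbatim): a Regular open-box local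
  maximiser of the MODEL `γ` with a submodular period pattern function is CUSP-FREE;
* SUPERMODULAR `F`: **`cuspSlope_le_greedy_period_of_supermodular`** (`σ` is the MINIMUM of its chamber functionals),
  **`cuspSlope_superadditive_of_supermodular_period`**, `concaveOn_cuspSlope_of_supermodular_period`,
  `cuspSlope_symm_nonpos_of_supermodular_period`, **`cuspSlope_conic_nonneg_of_supermodular_period`** (ascent directions
  add up);
* MODULAR `F`: **`cuspSlope_eq_linear_of_modular_period`** (`σ(δ) = Σ_k (F{k} − F∅)·φ_k(δ)/h_k(a)`, ONE linear
  functional on `ℝ⁸`), `cuspSlope_neg_of_modular_period` (`σ(−δ) = −σ(δ)`), `cuspSlope_eq_zero_of_modular_period_of_nonpos`.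
NOT here: the type of `F` at any named direction; `γ`, C2, S-E, `ζ(5)`.
-/

noncomputable section

open Set MeasureTheory Finset
open scoped Topology

namespace Summit.KontsevichZagierPeriods.Zeta5Search.Barrier.ConeGamma

/-! ### Submodular period: `σ` is the maximum of its chamber functionals -/

/-- **A SUBMODULAR PERIOD PATTERN FUNCTION: EVERY CHAMBER FUNCTIONAL UNDER-ESTIMATES `σ`.** With the data of
`cuspSlope_eq_lovasz_period` and `F` submodular on the subsets of the 28 forms: for every generic `δ₀` and EVERY `δ`,
`Σ_k (F(P≤(k)) − F(P<(k))) · φ_k(δ)/h_k(a) ≤ cuspSlope a T δ` (Edmonds' bound at the period level). -/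
theorem greedy_period_le_cuspSlope_of_submodular {a : Dir} (hpos : ∀ k, 0 < h28 a k) {T : ℝ} (hT : 0 < T)
    (hper : ∀ k : Fin 28, ∃ z : ℤ, T * h28 a k = z)
    {M : ℕ → Finset (Fin 28)} {f : ℕ → Finset (Fin 28) → ℝ}
    (hf : ∀ m, m + 1 < (bkpts a T).card → ∀ Δ : Fin 8 → ℝ, (∀ k, |phiForm Δ k| < 1) →
      (∀ k, |phiForm Δ k| < wallDist a T) →
        (torusN (bkpt a T m • sParam a + Δ) : ℝ) = f m ((M m).filter fun k => 0 ≤ phiForm Δ k))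
    {F : Finset (Fin 28) → ℝ} (hF : ∀ A, F A = ∑ m ∈ Finset.range ((bkpts a T).card - 1), f m (A ∩ M m))
    (hsub : ∀ A B : Finset (Fin 28), F (A ∪ B) + F (A ∩ B) ≤ F A + F B)
    {δ₀ : Fin 8 → ℝ} (hgen : ∀ k l : Fin 28, k ≠ l → phiForm δ₀ k / h28 a k ≠ phiForm δ₀ l / h28 a l)
    (δ : Fin 8 → ℝ) :
    ∑ k, (F (Finset.univ.filter fun l => phiForm δ₀ k / h28 a k ≤ phiForm δ₀ l / h28 a l) -
        F (Finset.univ.filter fun l => phiForm δ₀ k / h28 a k < phiForm δ₀ l / h28 a l)) *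
      (phiForm δ k / h28 a k) ≤ cuspSlope a T δ := by
  classical
  obtain ⟨n, d, hd0, hdn, hmono, hflip, hflipM⟩ := exists_member_chain hpos 0 Finset.univ δ
  have hflip' : ∀ k, ∃ i ≤ n, d i = -(phiForm δ k / h28 a k) := fun k => hflip k ⟨0, by simp⟩
  rw [cuspSlope_eq_lovasz_period hpos hT hper hf hF δ hd0 hdn (fun j hj => (hmono j hj).le) hflip']
  have hgen' : ∀ k ∈ (Finset.univ : Finset (Fin 28)), ∀ l ∈ (Finset.univ : Finset (Fin 28)), k ≠ l →
      phiForm δ₀ k / h28 a k ≠ phiForm δ₀ l / h28 a l := fun k _ l _ hkl => hgen k l hkl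
  have key := greedy_le_lovasz_of_submodular (M := Finset.univ) (ρ := fun k => phiForm δ₀ k / h28 a k) hgen'
    (fun A B _ _ => hsub A B) (fun k => -(phiForm δ k / h28 a k)) hmono hflipM
  simp only [neg_neg] at key
  exact key

/-- **SUBMODULAR PERIOD ⇒ SUBADDITIVE CUSP SLOPE**: `cuspSlope a T (δ + δ') ≤ cuspSlope a T δ + cuspSlope a T δ'`. -/
theorem cuspSlope_subadditive_of_submodular_period {a : Dir} (hpos : ∀ k, 0 < h28 a k) {T : ℝ} (hT : 0 < T)
    (hper : ∀ k : Fin 28, ∃ z : ℤ, T * h28 a k = z)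
    {M : ℕ → Finset (Fin 28)} {f : ℕ → Finset (Fin 28) → ℝ}
    (hf : ∀ m, m + 1 < (bkpts a T).card → ∀ Δ : Fin 8 → ℝ, (∀ k, |phiForm Δ k| < 1) →
      (∀ k, |phiForm Δ k| < wallDist a T) →
        (torusN (bkpt a T m • sParam a + Δ) : ℝ) = f m ((M m).filter fun k => 0 ≤ phiForm Δ k))
    {F : Finset (Fin 28) → ℝ} (hF : ∀ A, F A = ∑ m ∈ Finset.range ((bkpts a T).card - 1), f m (A ∩ M m))
    (hsub : ∀ A B : Finset (Fin 28), F (A ∪ B) + F (A ∩ B) ≤ F A + F B) (δ δ' : Fin 8 → ℝ) :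
    cuspSlope a T (δ + δ') ≤ cuspSlope a T δ + cuspSlope a T δ' := by
  obtain ⟨δ₀, hgen, href⟩ := exists_generic_refines hpos (δ + δ')
  rw [cuspSlope_eq_greedy_period_of_refines hpos hT hper hf hF hgen (δ + δ') href]
  have hB := greedy_period_le_cuspSlope_of_submodular hpos hT hper hf hF hsub hgen δ
  have hB' := greedy_period_le_cuspSlope_of_submodular hpos hT hper hf hF hsub hgen δ'
  have hsplit : ∀ k : Fin 28, phiForm (δ + δ') k / h28 a k = phiForm δ k / h28 a k + phiForm δ' k / h28 a k :=
    fun k => by rw [phiForm_add, add_div]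
  simp only [hsplit, mul_add, Finset.sum_add_distrib]
  exact add_le_add hB hB'

/-- **… hence CONVEX** (subadditive and degree-1 homogeneous, P2 g28's `cuspSlope_smul`). -/
theorem convexOn_cuspSlope_of_submodular_period {a : Dir} (hpos : ∀ k, 0 < h28 a k) {T : ℝ} (hT : 0 < T)
    (hper : ∀ k : Fin 28, ∃ z : ℤ, T * h28 a k = z)
    {M : ℕ → Finset (Fin 28)} {f : ℕ → Finset (Fin 28) → ℝ}
    (hf : ∀ m, m + 1 < (bkpts a T).card → ∀ Δ : Fin 8 → ℝ, (∀ k, |phiForm Δ k| < 1) →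
      (∀ k, |phiForm Δ k| < wallDist a T) →
        (torusN (bkpt a T m • sParam a + Δ) : ℝ) = f m ((M m).filter fun k => 0 ≤ phiForm Δ k))
    {F : Finset (Fin 28) → ℝ} (hF : ∀ A, F A = ∑ m ∈ Finset.range ((bkpts a T).card - 1), f m (A ∩ M m))
    (hsub : ∀ A B : Finset (Fin 28), F (A ∪ B) + F (A ∩ B) ≤ F A + F B) :
    ConvexOn ℝ Set.univ (cuspSlope a T) := by
  refine ⟨convex_univ, fun x _ y _ s t hs ht hst => ?_⟩
  have h := cuspSlope_subadditive_of_submodular_period hpos hT hper hf hF hsub (s • x) (t • y)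
  rcases hs.eq_or_lt with rfl | hs'
  · simp only [zero_smul, zero_add] at hst ⊢
    rw [hst, one_smul, one_smul]
  rcases ht.eq_or_lt with rfl | ht'
  · simp only [zero_smul, add_zero] at hst ⊢
    rw [hst, one_smul, one_smul]
  rw [cuspSlope_smul hpos hT hper x hs', cuspSlope_smul hpos hT hper y ht'] at h
  simpa only [smul_eq_mul] using h

/-- **… and the symmetric part is non-negative**: `0 ≤ σ(δ) + σ(−δ)` for every `δ`. -/
theorem cuspSlope_symm_nonneg_of_submodular_period {a : Dir} (hpos : ∀ k, 0 < h28 a k) {T : ℝ} (hT : 0 < T)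
    (hper : ∀ k : Fin 28, ∃ z : ℤ, T * h28 a k = z)
    {M : ℕ → Finset (Fin 28)} {f : ℕ → Finset (Fin 28) → ℝ}
    (hf : ∀ m, m + 1 < (bkpts a T).card → ∀ Δ : Fin 8 → ℝ, (∀ k, |phiForm Δ k| < 1) →
      (∀ k, |phiForm Δ k| < wallDist a T) →
        (torusN (bkpt a T m • sParam a + Δ) : ℝ) = f m ((M m).filter fun k => 0 ≤ phiForm Δ k))
    {F : Finset (Fin 28) → ℝ} (hF : ∀ A, F A = ∑ m ∈ Finset.range ((bkpts a T).card - 1), f m (A ∩ M m))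
    (hsub : ∀ A B : Finset (Fin 28), F (A ∪ B) + F (A ∩ B) ≤ F A + F B) (δ : Fin 8 → ℝ) :
    0 ≤ cuspSlope a T δ + cuspSlope a T (-δ) := by
  have h := cuspSlope_subadditive_of_submodular_period hpos hT hper hf hF hsub δ (-δ)
  rwa [add_neg_cancel, cuspSlope_zero] at h

/-- **SUBMODULAR PERIOD: `σ ≤ 0` IN EVERY DIRECTION FORCES `σ ≡ 0`.** (Each `σ(δ)`, `σ(−δ)` is `≤ 0`, their sum
`≥ 0`.) The cusp cannot be a strict descent in all directions: a convex `σ` that never ascends is identically zero. -/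
theorem cuspSlope_eq_zero_of_submodular_period_of_nonpos {a : Dir} (hpos : ∀ k, 0 < h28 a k) {T : ℝ} (hT : 0 < T)
    (hper : ∀ k : Fin 28, ∃ z : ℤ, T * h28 a k = z)
    {M : ℕ → Finset (Fin 28)} {f : ℕ → Finset (Fin 28) → ℝ}
    (hf : ∀ m, m + 1 < (bkpts a T).card → ∀ Δ : Fin 8 → ℝ, (∀ k, |phiForm Δ k| < 1) →
      (∀ k, |phiForm Δ k| < wallDist a T) →
        (torusN (bkpt a T m • sParam a + Δ) : ℝ) = f m ((M m).filter fun k => 0 ≤ phiForm Δ k))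
    {F : Finset (Fin 28) → ℝ} (hF : ∀ A, F A = ∑ m ∈ Finset.range ((bkpts a T).card - 1), f m (A ∩ M m))
    (hsub : ∀ A B : Finset (Fin 28), F (A ∪ B) + F (A ∩ B) ≤ F A + F B)
    (hnonpos : ∀ δ, cuspSlope a T δ ≤ 0) (δ : Fin 8 → ℝ) : cuspSlope a T δ = 0 := by
  have h1 := hnonpos δ
  have h2 := hnonpos (-δ)
  have h3 := cuspSlope_symm_nonneg_of_submodular_period hpos hT hper hf hF hsub δ
  linarith

/-- **A LOCAL MAXIMISER WITH A SUBMODULAR PERIOD PATTERN FUNCTION IS CUSP-FREE.** At a Regular OPEN-box direction with a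
period `T`, `Q = C₁ + δ₂₈ − Φ > 0`, which is a local maximiser of the MODEL `γ` (P2 g23's hypotheses of
`cuspSlope_nonpos_of_isLocalMax`, verbatim): if the period pattern function is submodular then `cuspSlope a T δ = 0`
for EVERY `δ`. -/
theorem cuspSlope_eq_zero_of_submodular_period_of_isLocalMax {a : Dir}
    (hopen : ∀ j : Fin 7, 0 < sParam a j.succ ∧ sParam a j.succ < sParam a 0)
    {T : ℝ} (hT : 0 < T) (hper : ∀ k : Fin 28, ∃ z : ℤ, T * h28 a k = z)
    (hQ : 0 < C1 a + delta28 a - phi30 a) (hreg : Regular a) (hmax : IsLocalMax gamma a)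
    {M : ℕ → Finset (Fin 28)} {f : ℕ → Finset (Fin 28) → ℝ}
    (hf : ∀ m, m + 1 < (bkpts a T).card → ∀ Δ : Fin 8 → ℝ, (∀ k, |phiForm Δ k| < 1) →
      (∀ k, |phiForm Δ k| < wallDist a T) →
        (torusN (bkpt a T m • sParam a + Δ) : ℝ) = f m ((M m).filter fun k => 0 ≤ phiForm Δ k))
    {F : Finset (Fin 28) → ℝ} (hF : ∀ A, F A = ∑ m ∈ Finset.range ((bkpts a T).card - 1), f m (A ∩ M m))
    (hsub : ∀ A B : Finset (Fin 28), F (A ∪ B) + F (A ∩ B) ≤ F A + F B) (δ : Fin 8 → ℝ) :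
    cuspSlope a T δ = 0 :=
  cuspSlope_eq_zero_of_submodular_period_of_nonpos (h28_pos_of_openBox hopen) hT hper hf hF hsub
    (fun δ' => cuspSlope_nonpos_of_isLocalMax hopen hT hper δ' hQ hreg hmax) δ

/-! ### Supermodular period: `σ` is the minimum of its chamber functionals -/

/-- **A SUPERMODULAR PERIOD PATTERN FUNCTION: `σ` IS DOMINATED BY EVERY CHAMBER FUNCTIONAL**: for every generic `δ₀` and
every `δ`, `cuspSlope a T δ ≤ Σ_k (F(P≤(k)) − F(P<(k))) · φ_k(δ)/h_k(a)`. -/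
theorem cuspSlope_le_greedy_period_of_supermodular {a : Dir} (hpos : ∀ k, 0 < h28 a k) {T : ℝ} (hT : 0 < T)
    (hper : ∀ k : Fin 28, ∃ z : ℤ, T * h28 a k = z)
    {M : ℕ → Finset (Fin 28)} {f : ℕ → Finset (Fin 28) → ℝ}
    (hf : ∀ m, m + 1 < (bkpts a T).card → ∀ Δ : Fin 8 → ℝ, (∀ k, |phiForm Δ k| < 1) →
      (∀ k, |phiForm Δ k| < wallDist a T) →
        (torusN (bkpt a T m • sParam a + Δ) : ℝ) = f m ((M m).filter fun k => 0 ≤ phiForm Δ k))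
    {F : Finset (Fin 28) → ℝ} (hF : ∀ A, F A = ∑ m ∈ Finset.range ((bkpts a T).card - 1), f m (A ∩ M m))
    (hsuper : ∀ A B : Finset (Fin 28), F A + F B ≤ F (A ∪ B) + F (A ∩ B))
    {δ₀ : Fin 8 → ℝ} (hgen : ∀ k l : Fin 28, k ≠ l → phiForm δ₀ k / h28 a k ≠ phiForm δ₀ l / h28 a l)
    (δ : Fin 8 → ℝ) :
    cuspSlope a T δ ≤
      ∑ k, (F (Finset.univ.filter fun l => phiForm δ₀ k / h28 a k ≤ phiForm δ₀ l / h28 a l) -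
          F (Finset.univ.filter fun l => phiForm δ₀ k / h28 a k < phiForm δ₀ l / h28 a l)) *
        (phiForm δ k / h28 a k) := by
  classical
  obtain ⟨n, d, hd0, hdn, hmono, hflip, hflipM⟩ := exists_member_chain hpos 0 Finset.univ δ
  have hflip' : ∀ k, ∃ i ≤ n, d i = -(phiForm δ k / h28 a k) := fun k => hflip k ⟨0, by simp⟩
  rw [cuspSlope_eq_lovasz_period hpos hT hper hf hF δ hd0 hdn (fun j hj => (hmono j hj).le) hflip']
  have hgen' : ∀ k ∈ (Finset.univ : Finset (Fin 28)), ∀ l ∈ (Finset.univ : Finset (Fin 28)), k ≠ l →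
      phiForm δ₀ k / h28 a k ≠ phiForm δ₀ l / h28 a l := fun k _ l _ hkl => hgen k l hkl
  have key := lovasz_le_greedy_of_supermodular (M := Finset.univ) (ρ := fun k => phiForm δ₀ k / h28 a k) hgen'
    (fun A B _ _ => hsuper A B) (fun k => -(phiForm δ k / h28 a k)) hmono hflipM
  simp only [neg_neg] at key
  exact key

/-- **SUPERMODULAR PERIOD ⇒ SUPERADDITIVE CUSP SLOPE**: `cuspSlope a T δ + cuspSlope a T δ' ≤ cuspSlope a T (δ + δ')`. -/
theorem cuspSlope_superadditive_of_supermodular_period {a : Dir} (hpos : ∀ k, 0 < h28 a k) {T : ℝ} (hT : 0 < T)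
    (hper : ∀ k : Fin 28, ∃ z : ℤ, T * h28 a k = z)
    {M : ℕ → Finset (Fin 28)} {f : ℕ → Finset (Fin 28) → ℝ}
    (hf : ∀ m, m + 1 < (bkpts a T).card → ∀ Δ : Fin 8 → ℝ, (∀ k, |phiForm Δ k| < 1) →
      (∀ k, |phiForm Δ k| < wallDist a T) →
        (torusN (bkpt a T m • sParam a + Δ) : ℝ) = f m ((M m).filter fun k => 0 ≤ phiForm Δ k))
    {F : Finset (Fin 28) → ℝ} (hF : ∀ A, F A = ∑ m ∈ Finset.range ((bkpts a T).card - 1), f m (A ∩ M m))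
    (hsuper : ∀ A B : Finset (Fin 28), F A + F B ≤ F (A ∪ B) + F (A ∩ B)) (δ δ' : Fin 8 → ℝ) :
    cuspSlope a T δ + cuspSlope a T δ' ≤ cuspSlope a T (δ + δ') := by
  obtain ⟨δ₀, hgen, href⟩ := exists_generic_refines hpos (δ + δ')
  rw [cuspSlope_eq_greedy_period_of_refines hpos hT hper hf hF hgen (δ + δ') href]
  have hB := cuspSlope_le_greedy_period_of_supermodular hpos hT hper hf hF hsuper hgen δ
  have hB' := cuspSlope_le_greedy_period_of_supermodular hpos hT hper hf hF hsuper hgen δ'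
  have hsplit : ∀ k : Fin 28, phiForm (δ + δ') k / h28 a k = phiForm δ k / h28 a k + phiForm δ' k / h28 a k :=
    fun k => by rw [phiForm_add, add_div]
  simp only [hsplit, mul_add, Finset.sum_add_distrib]
  exact add_le_add hB hB'

/-- **… hence CONCAVE.** -/
theorem concaveOn_cuspSlope_of_supermodular_period {a : Dir} (hpos : ∀ k, 0 < h28 a k) {T : ℝ} (hT : 0 < T)
    (hper : ∀ k : Fin 28, ∃ z : ℤ, T * h28 a k = z)
    {M : ℕ → Finset (Fin 28)} {f : ℕ → Finset (Fin 28) → ℝ}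
    (hf : ∀ m, m + 1 < (bkpts a T).card → ∀ Δ : Fin 8 → ℝ, (∀ k, |phiForm Δ k| < 1) →
      (∀ k, |phiForm Δ k| < wallDist a T) →
        (torusN (bkpt a T m • sParam a + Δ) : ℝ) = f m ((M m).filter fun k => 0 ≤ phiForm Δ k))
    {F : Finset (Fin 28) → ℝ} (hF : ∀ A, F A = ∑ m ∈ Finset.range ((bkpts a T).card - 1), f m (A ∩ M m))
    (hsuper : ∀ A B : Finset (Fin 28), F A + F B ≤ F (A ∪ B) + F (A ∩ B)) :
    ConcaveOn ℝ Set.univ (cuspSlope a T) := by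
  refine ⟨convex_univ, fun x _ y _ s t hs ht hst => ?_⟩
  have h := cuspSlope_superadditive_of_supermodular_period hpos hT hper hf hF hsuper (s • x) (t • y)
  rcases hs.eq_or_lt with rfl | hs'
  · simp only [zero_smul, zero_add] at hst ⊢
    rw [hst, one_smul, one_smul]
  rcases ht.eq_or_lt with rfl | ht'
  · simp only [zero_smul, add_zero] at hst ⊢
    rw [hst, one_smul, one_smul]
  rw [cuspSlope_smul hpos hT hper x hs', cuspSlope_smul hpos hT hper y ht'] at h
  simpa only [smul_eq_mul] using h

/-- **… and the symmetric part is non-positive**: `σ(δ) + σ(−δ) ≤ 0` for every `δ`. -/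
theorem cuspSlope_symm_nonpos_of_supermodular_period {a : Dir} (hpos : ∀ k, 0 < h28 a k) {T : ℝ} (hT : 0 < T)
    (hper : ∀ k : Fin 28, ∃ z : ℤ, T * h28 a k = z)
    {M : ℕ → Finset (Fin 28)} {f : ℕ → Finset (Fin 28) → ℝ}
    (hf : ∀ m, m + 1 < (bkpts a T).card → ∀ Δ : Fin 8 → ℝ, (∀ k, |phiForm Δ k| < 1) →
      (∀ k, |phiForm Δ k| < wallDist a T) →
        (torusN (bkpt a T m • sParam a + Δ) : ℝ) = f m ((M m).filter fun k => 0 ≤ phiForm Δ k))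
    {F : Finset (Fin 28) → ℝ} (hF : ∀ A, F A = ∑ m ∈ Finset.range ((bkpts a T).card - 1), f m (A ∩ M m))
    (hsuper : ∀ A B : Finset (Fin 28), F A + F B ≤ F (A ∪ B) + F (A ∩ B)) (δ : Fin 8 → ℝ) :
    cuspSlope a T δ + cuspSlope a T (-δ) ≤ 0 := by
  have h := cuspSlope_superadditive_of_supermodular_period hpos hT hper hf hF hsuper δ (-δ)
  rwa [add_neg_cancel, cuspSlope_zero] at h

/-- **ASCENT DIRECTIONS ADD UP** (supermodular period): `0 ≤ σ(δ)`, `0 ≤ σ(δ')`, `s, t ≥ 0` give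
`0 ≤ σ(s·δ + t·δ')` — the ascent set is a convex cone (containing the gauge line `ℝ·s(a)`, where `σ = 0`). -/
theorem cuspSlope_conic_nonneg_of_supermodular_period {a : Dir} (hpos : ∀ k, 0 < h28 a k) {T : ℝ} (hT : 0 < T)
    (hper : ∀ k : Fin 28, ∃ z : ℤ, T * h28 a k = z)
    {M : ℕ → Finset (Fin 28)} {f : ℕ → Finset (Fin 28) → ℝ}
    (hf : ∀ m, m + 1 < (bkpts a T).card → ∀ Δ : Fin 8 → ℝ, (∀ k, |phiForm Δ k| < 1) →
      (∀ k, |phiForm Δ k| < wallDist a T) →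
        (torusN (bkpt a T m • sParam a + Δ) : ℝ) = f m ((M m).filter fun k => 0 ≤ phiForm Δ k))
    {F : Finset (Fin 28) → ℝ} (hF : ∀ A, F A = ∑ m ∈ Finset.range ((bkpts a T).card - 1), f m (A ∩ M m))
    (hsuper : ∀ A B : Finset (Fin 28), F A + F B ≤ F (A ∪ B) + F (A ∩ B))
    {δ δ' : Fin 8 → ℝ} (hδ : 0 ≤ cuspSlope a T δ) (hδ' : 0 ≤ cuspSlope a T δ') {s t : ℝ} (hs : 0 ≤ s)
    (ht : 0 ≤ t) : 0 ≤ cuspSlope a T (s • δ + t • δ') := by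
  have hsup := cuspSlope_superadditive_of_supermodular_period hpos hT hper hf hF hsuper (s • δ) (t • δ')
  have hs1 : 0 ≤ cuspSlope a T (s • δ) := by
    rcases hs.eq_or_lt with rfl | hs'
    · rw [zero_smul, cuspSlope_zero]
    · rw [cuspSlope_smul hpos hT hper δ hs']; exact mul_nonneg hs hδ
  have ht1 : 0 ≤ cuspSlope a T (t • δ') := by
    rcases ht.eq_or_lt with rfl | ht'
    · rw [zero_smul, cuspSlope_zero]
    · rw [cuspSlope_smul hpos hT hper δ' ht']; exact mul_nonneg ht hδ'
  linarith

/-! ### Modular period: `σ` is linear -/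

/-- **A MODULAR PERIOD PATTERN FUNCTION MAKES THE CUSP SLOPE LINEAR**: for EVERY `δ`,
`cuspSlope a T δ = Σ_k (F{k} − F∅) · φ_k(δ)/h_k(a)` — one linear functional on all of `ℝ⁸`, no kink anywhere. -/
theorem cuspSlope_eq_linear_of_modular_period {a : Dir} (hpos : ∀ k, 0 < h28 a k) {T : ℝ} (hT : 0 < T)
    (hper : ∀ k : Fin 28, ∃ z : ℤ, T * h28 a k = z)
    {M : ℕ → Finset (Fin 28)} {f : ℕ → Finset (Fin 28) → ℝ}
    (hf : ∀ m, m + 1 < (bkpts a T).card → ∀ Δ : Fin 8 → ℝ, (∀ k, |phiForm Δ k| < 1) →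
      (∀ k, |phiForm Δ k| < wallDist a T) →
        (torusN (bkpt a T m • sParam a + Δ) : ℝ) = f m ((M m).filter fun k => 0 ≤ phiForm Δ k))
    {F : Finset (Fin 28) → ℝ} (hF : ∀ A, F A = ∑ m ∈ Finset.range ((bkpts a T).card - 1), f m (A ∩ M m))
    (hmod : ∀ A B : Finset (Fin 28), F (A ∪ B) + F (A ∩ B) = F A + F B) (δ : Fin 8 → ℝ) :
    cuspSlope a T δ = ∑ k, (F {k} - F ∅) * (phiForm δ k / h28 a k) := by
  classical
  obtain ⟨δ₀, hgen, href⟩ := exists_generic_refines hpos δ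
  rw [cuspSlope_eq_greedy_period_of_refines hpos hT hper hf hF hgen δ href]
  have hgen' : ∀ k ∈ (Finset.univ : Finset (Fin 28)), ∀ l ∈ (Finset.univ : Finset (Fin 28)), k ≠ l →
      phiForm δ₀ k / h28 a k ≠ phiForm δ₀ l / h28 a l := fun k _ l _ hkl => hgen k l hkl
  refine Finset.sum_congr rfl fun k _ => ?_
  obtain ⟨hins, hnot⟩ := prefix_le_eq_insert (ρ := fun k => phiForm δ₀ k / h28 a k) hgen' (Finset.mem_univ k)
  have h := hmod {k} (Finset.univ.filter fun l => phiForm δ₀ k / h28 a k < phiForm δ₀ l / h28 a l)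
  rw [Finset.singleton_inter_of_notMem hnot, ← Finset.insert_eq, ← hins] at h
  congr 1
  linarith

/-- **… so it is odd**: `σ(−δ) = −σ(δ)` (modular period). -/
theorem cuspSlope_neg_of_modular_period {a : Dir} (hpos : ∀ k, 0 < h28 a k) {T : ℝ} (hT : 0 < T)
    (hper : ∀ k : Fin 28, ∃ z : ℤ, T * h28 a k = z)
    {M : ℕ → Finset (Fin 28)} {f : ℕ → Finset (Fin 28) → ℝ}
    (hf : ∀ m, m + 1 < (bkpts a T).card → ∀ Δ : Fin 8 → ℝ, (∀ k, |phiForm Δ k| < 1) →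
      (∀ k, |phiForm Δ k| < wallDist a T) →
        (torusN (bkpt a T m • sParam a + Δ) : ℝ) = f m ((M m).filter fun k => 0 ≤ phiForm Δ k))
    {F : Finset (Fin 28) → ℝ} (hF : ∀ A, F A = ∑ m ∈ Finset.range ((bkpts a T).card - 1), f m (A ∩ M m))
    (hmod : ∀ A B : Finset (Fin 28), F (A ∪ B) + F (A ∩ B) = F A + F B) (δ : Fin 8 → ℝ) :
    cuspSlope a T (-δ) = -cuspSlope a T δ := by
  rw [cuspSlope_eq_linear_of_modular_period hpos hT hper hf hF hmod δ,
    cuspSlope_eq_linear_of_modular_period hpos hT hper hf hF hmod (-δ), ← Finset.sum_neg_distrib]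
  exact Finset.sum_congr rfl fun k _ => by rw [phiForm_neg]; ring

/-- **… and `σ ≤ 0` in every direction forces `σ ≡ 0`** (modular period: a linear functional that never ascends
vanishes). -/
theorem cuspSlope_eq_zero_of_modular_period_of_nonpos {a : Dir} (hpos : ∀ k, 0 < h28 a k) {T : ℝ} (hT : 0 < T)
    (hper : ∀ k : Fin 28, ∃ z : ℤ, T * h28 a k = z)
    {M : ℕ → Finset (Fin 28)} {f : ℕ → Finset (Fin 28) → ℝ}
    (hf : ∀ m, m + 1 < (bkpts a T).card → ∀ Δ : Fin 8 → ℝ, (∀ k, |phiForm Δ k| < 1) →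
      (∀ k, |phiForm Δ k| < wallDist a T) →
        (torusN (bkpt a T m • sParam a + Δ) : ℝ) = f m ((M m).filter fun k => 0 ≤ phiForm Δ k))
    {F : Finset (Fin 28) → ℝ} (hF : ∀ A, F A = ∑ m ∈ Finset.range ((bkpts a T).card - 1), f m (A ∩ M m))
    (hmod : ∀ A B : Finset (Fin 28), F (A ∪ B) + F (A ∩ B) = F A + F B)
    (hnonpos : ∀ δ, cuspSlope a T δ ≤ 0) (δ : Fin 8 → ℝ) : cuspSlope a T δ = 0 := by
  have h1 := hnonpos δ
  have h2 := hnonpos (-δ)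
  rw [cuspSlope_neg_of_modular_period hpos hT hper hf hF hmod δ] at h2
  linarith

end Summit.KontsevichZagierPeriods.Zeta5Search.Barrier.ConeGamma

end
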